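import Literature.NumberTheory.PAdicHodge.BmaxPlusFormalLogDivisionTower
import Literature.NumberTheory.PAdicHodge.BmaxPlusFormalLogPeriodMap
import Literature.NumberTheory.PAdicHodge.BmaxPlusFontaineLineSharp
import Literature.NumberTheory.PAdicHodge.BmaxPlusFrobeniusEigenTeichLog
import HarnessLib

/-!
# The Legendre relation of the `A_max`-periods of the Tate module: `p²·(Λ·φΛ′ − φΛ·Λ′) = λ·t` with `λ ∈ ℤ_p`

Topic `Literature/NumberTheory/PAdicHodge`; namespace `Literature.NumberTheory.PAdicHodge.AinfTop`. THEOREMS ONLY (no definition, no named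
fact, no instance, no `sorry`). Brick B8a of the φ-road of line `kato_lever` (crux K★ `stmt-BirchSwinnertonDyer-22226`, memos
`Cruxes/StarredOptimalManinUnitFiveSeven/Lines/kato-lever-K2-phi-road.md` §0/§2 and `…-tdiv-g25.md`): the two halves meet —

* (M) (edix-p4 g25, `BmaxPlusFormalLogDivisionTower` / `…PeriodMap`): for `W/ℤ` with `log_W` of Honda type `p − aT + T²`, the `A_max`-periods
  `Λ = Λ_N(ι[ũ], z)` of `[p]_W`-division sequences satisfy `φD = pD` for `D = Λ·φΛ′ − φΛ·Λ′`, and `θ(D) = 0` when `u, u′` are TORSION sequences;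
* (B7) (edix-p1 g25, `BmaxPlusTDivisibilityAllPrimes`): FONTAINE'S LEMMA `φx = px ∧ θx = 0 ⇒ p²x = ι(λ)t`.

Hence ★★★ `exists_sq_mul_det_eq_zpToAinf_mul_tBmax` — **`p²·D(u, u′) = ι(λ)·t` with `λ ∈ ℤ_p`** for any two torsion sequences: the LEGENDRE RELATION of the
φ-road with a `ℚ_p`-VALUED (not `F`-valued) constant, `D(u,u′) = e′(u,u′)·t`, `e′ = λ/p² ∈ p^{−2}ℤ_p` (`det [[0,−p],[1,a]] = p ∈ ℚ_p`); for `p` odd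
sharply `D = ι(μ)·t/p` (`eq_zpToAinf_mul_of_det`), and in the socket's `B_dR⁺`-currency every comparison limit `L_D` of `D` modulo `Fil^k` satisfies
`p²L_D − λ·t_dR ∈ ξ^k B_dR⁺` (`exists_sq_mul_sub_smul_tBdR_mem_of_det`). Infrastructure only; BSD / K★ are not proved by any of this.

## References
* [FontaineAsterisque223III] J.-M. Fontaine, *Le corps des périodes p-adiques*, Astérisque 223 (1994), Exp. II §1.5, Exp. III Th. 5.3.7.
* [Colmez1992PeriodesAbeliennes] P. Colmez, *Périodes p-adiques des variétés abéliennes*, Math. Ann. 292 (1992), §2 (Legendre relation).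
-/

noncomputable section

open Ideal WittVector MvPowerSeries ValuativeRel Field

namespace Literature.NumberTheory.PAdicHodge

namespace AinfTop

open Literature.NumberTheory.GaloisRepresentations Literature.NumberTheory.GaloisRepresentations.IsNonarchimedeanLocalField
open Literature.NumberTheory.GaloisRepresentations.LubinTate Literature.NumberTheory.EllipticCurves
open Literature.RingTheory.FormalGroups Literature.AlgebraicGeometry.Resolution

variable {F : Type} [Field F] [ValuativeRel F] [TopologicalSpace F] [IsNonarchimedeanLocalField F]
  [CharZero F] {p : ℕ} [Fact p.Prime] [Fact (¬ IsUnit (p : integerC F))]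
  [IsAdicComplete (Ideal.span {(p : integerC F)}) (integerC F)]
  {hθ : Function.Surjective (fontaineTheta (integerC F) p)} (W : WeierstrassCurve ℤ)

set_option maxHeartbeats 1600000 in
/-- ★★★ **The Legendre relation in `A_max` with a `ℤ_p`-constant.** For `W/ℤ` with `log_W` of Honda type `p − aT + T²` (`he`), two TORSION
`[p]_W`-division sequences `u, u′` of `Ŵ(𝔪_{ℂ_F})` (`u₀ = u′₀ = 0`) with `A_max`-periods `Λ = Λ_N(ι[ũ], z)`, `Λ′ = Λ_{N′}(ι[ũ′], z′)`:
**`p²·(Λ·φΛ′ − φΛ·Λ′) = ι(λ)·t` for some `λ ∈ ℤ_p`** (`φD = pD`, `θD = 0`, and Fontaine's lemma).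
[cite: Colmez1992PeriodesAbeliennes, §2] [cite: FontaineAsterisque223III, Exp. III Th. 5.3.7] -/
theorem exists_sq_mul_det_eq_zpToAinf_mul_tBmax (a : ℤ_[p]) (e : ℕ → ℤ_[p])
    (he : ∀ m : ℕ, m ≠ 0 → (m : ℤ_[p]) * e m =
      GaloisContinuity.formalLogNum W p m - (if p ∣ m then a * GaloisContinuity.formalLogNum W p (m / p) else 0) +
        (if p ^ 2 ∣ m then (p : ℤ_[p]) * GaloisContinuity.formalLogNum W p (m / p ^ 2) else 0))
    {u u' : ℕ → (maxNilIdealC F).toIdeal} (hup : ∀ n, mulPC F p W (u (n + 1)) = u n) (hup' : ∀ n, mulPC F p W (u' (n + 1)) = u' n)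
    (hu₀ : (((u 0 : (maxNilIdealC F).toIdeal) : CBall F) : CompletedAlgClosure F) = 0)
    (hu'₀ : (((u' 0 : (maxNilIdealC F).toIdeal) : CBall F) : CompletedAlgClosure F) = 0)
    {N N' : ℕ} (hN : 1 ≤ N) (hN' : 1 ≤ N') {z z' : bmaxZero F p}
    (hz : algebraMap (Ainf (p := p) F) (bmaxZero F p)
        ((AinfTop.of F p).symm (((divisionLiftPt W hθ u hup).val : (nilTheta F p hθ).toIdeal) : AinfTop F p)) ^ N =
      (p : bmaxZero F p) * z)
    (hz' : algebraMap (Ainf (p := p) F) (bmaxZero F p)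
        ((AinfTop.of F p).symm (((divisionLiftPt W hθ u' hup').val : (nilTheta F p hθ).toIdeal) : AinfTop F p)) ^ N' =
      (p : bmaxZero F p) * z') :
    let Λ := PadicLogSeries.logSum ((algebraMap (Ainf (p := p) F) (bmaxZero F p)).comp zpToAinf) (GaloisContinuity.formalLogNum W p) N
      (algebraMap (Ainf (p := p) F) (bmaxZero F p)
        ((AinfTop.of F p).symm (((divisionLiftPt W hθ u hup).val : (nilTheta F p hθ).toIdeal) : AinfTop F p))) z
    let Λ' := PadicLogSeries.logSum ((algebraMap (Ainf (p := p) F) (bmaxZero F p)).comp zpToAinf) (GaloisContinuity.formalLogNum W p) N'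
      (algebraMap (Ainf (p := p) F) (bmaxZero F p)
        ((AinfTop.of F p).symm (((divisionLiftPt W hθ u' hup').val : (nilTheta F p hθ).toIdeal) : AinfTop F p))) z'
    ∃ lam : ℤ_[p], (p : BmaxPlus F p) ^ 2 * (Λ * frobBmaxPlus F p Λ' - frobBmaxPlus F p Λ * Λ') =
      ainfToBmaxPlus F p (zpToAinf lam) * tBmax := by
  intro Λ Λ'
  have hφ := frobBmaxPlus_det_logSum_divisionLiftPt W (hθ := hθ) a e he hup hup' hN hN' hz hz'
  have hθ0 : thetaBmaxPlus F p (Λ * frobBmaxPlus F p Λ' - frobBmaxPlus F p Λ * Λ') = 0 :=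
    thetaBmaxPlus_det_eq_zero (frobBmaxPlus F p)
      (thetaBmaxPlus_logSum_divisionLiftPt_eq_zero W (GaloisContinuity.formalLogNum W p) hup hu₀ hN hz)
      (thetaBmaxPlus_logSum_divisionLiftPt_eq_zero W (GaloisContinuity.formalLogNum W p) hup' hu'₀ hN' hz')
  exact exists_sq_mul_eq_zpToAinf_mul_tBmax' hθ hφ hθ0

set_option maxHeartbeats 1600000 in
/-- ★★ **Sharp form for `p` odd: `D(u, u′) = ι(μ)·t/p`**, `μ ∈ ℤ_p`, for the Legendre determinant of the `A_max`-periods of two torsion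
sequences (`(A_max)^{φ=p} ∩ ker θ = ℤ_p·t/p`, `BmaxPlusFontaineLineSharp`). [cite: Colmez1992PeriodesAbeliennes, §2]
[cite: FontaineAsterisque223III, Exp. III Th. 5.3.7] -/
theorem exists_det_eq_zpToAinf_mul_of_tBmax_eq_natCast_mul (hp : p ≠ 2) {t' : BmaxPlus F p}
    (ht : tBmax (F := F) (p := p) = (p : BmaxPlus F p) * t') (a : ℤ_[p]) (e : ℕ → ℤ_[p])
    (he : ∀ m : ℕ, m ≠ 0 → (m : ℤ_[p]) * e m =
      GaloisContinuity.formalLogNum W p m - (if p ∣ m then a * GaloisContinuity.formalLogNum W p (m / p) else 0) +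
        (if p ^ 2 ∣ m then (p : ℤ_[p]) * GaloisContinuity.formalLogNum W p (m / p ^ 2) else 0))
    {u u' : ℕ → (maxNilIdealC F).toIdeal} (hup : ∀ n, mulPC F p W (u (n + 1)) = u n) (hup' : ∀ n, mulPC F p W (u' (n + 1)) = u' n)
    (hu₀ : (((u 0 : (maxNilIdealC F).toIdeal) : CBall F) : CompletedAlgClosure F) = 0)
    (hu'₀ : (((u' 0 : (maxNilIdealC F).toIdeal) : CBall F) : CompletedAlgClosure F) = 0)
    {N N' : ℕ} (hN : 1 ≤ N) (hN' : 1 ≤ N') {z z' : bmaxZero F p}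
    (hz : algebraMap (Ainf (p := p) F) (bmaxZero F p)
        ((AinfTop.of F p).symm (((divisionLiftPt W hθ u hup).val : (nilTheta F p hθ).toIdeal) : AinfTop F p)) ^ N =
      (p : bmaxZero F p) * z)
    (hz' : algebraMap (Ainf (p := p) F) (bmaxZero F p)
        ((AinfTop.of F p).symm (((divisionLiftPt W hθ u' hup').val : (nilTheta F p hθ).toIdeal) : AinfTop F p)) ^ N' =
      (p : bmaxZero F p) * z') :
    let Λ := PadicLogSeries.logSum ((algebraMap (Ainf (p := p) F) (bmaxZero F p)).comp zpToAinf) (GaloisContinuity.formalLogNum W p) N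
      (algebraMap (Ainf (p := p) F) (bmaxZero F p)
        ((AinfTop.of F p).symm (((divisionLiftPt W hθ u hup).val : (nilTheta F p hθ).toIdeal) : AinfTop F p))) z
    let Λ' := PadicLogSeries.logSum ((algebraMap (Ainf (p := p) F) (bmaxZero F p)).comp zpToAinf) (GaloisContinuity.formalLogNum W p) N'
      (algebraMap (Ainf (p := p) F) (bmaxZero F p)
        ((AinfTop.of F p).symm (((divisionLiftPt W hθ u' hup').val : (nilTheta F p hθ).toIdeal) : AinfTop F p))) z'
    ∃ mu : ℤ_[p], Λ * frobBmaxPlus F p Λ' - frobBmaxPlus F p Λ * Λ' = ainfToBmaxPlus F p (zpToAinf mu) * t' := by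
  intro Λ Λ'
  have hφ := frobBmaxPlus_det_logSum_divisionLiftPt W (hθ := hθ) a e he hup hup' hN hN' hz hz'
  have hθ0 : thetaBmaxPlus F p (Λ * frobBmaxPlus F p Λ' - frobBmaxPlus F p Λ * Λ') = 0 :=
    thetaBmaxPlus_det_eq_zero (frobBmaxPlus F p)
      (thetaBmaxPlus_logSum_divisionLiftPt_eq_zero W (GaloisContinuity.formalLogNum W p) hup hu₀ hN hz)
      (thetaBmaxPlus_logSum_divisionLiftPt_eq_zero W (GaloisContinuity.formalLogNum W p) hup' hu'₀ hN' hz')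
  exact eq_zpToAinf_mul_of_tBmax_eq_natCast_mul hθ hp ht hφ hθ0

set_option maxHeartbeats 1600000 in
/-- ★★ **The Legendre relation in the socket's `B_dR⁺`-currency**: for every comparison limit `L_D` of the determinant `D(u,u′)` modulo `Fil^k`
(`BmaxPlusBdRModFil.exists_bdR_lim_modFil`), `p²·L_D − λ·t_dR ∈ ξ^k B_dR⁺` with `λ ∈ ℤ_p` (`BmaxPlusFrobeniusEigenTeichLog.exists_sq_mul_sub_smul_tBdR_mem_of_bdR_lim_modFil`).
[cite: Colmez1992PeriodesAbeliennes, §2] [cite: FontaineAsterisque223III, Exp. III Th. 5.3.7] -/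
theorem exists_sq_mul_sub_smul_tBdR_mem_of_det (a : ℤ_[p]) (e : ℕ → ℤ_[p])
    (he : ∀ m : ℕ, m ≠ 0 → (m : ℤ_[p]) * e m =
      GaloisContinuity.formalLogNum W p m - (if p ∣ m then a * GaloisContinuity.formalLogNum W p (m / p) else 0) +
        (if p ^ 2 ∣ m then (p : ℤ_[p]) * GaloisContinuity.formalLogNum W p (m / p ^ 2) else 0))
    {u u' : ℕ → (maxNilIdealC F).toIdeal} (hup : ∀ n, mulPC F p W (u (n + 1)) = u n) (hup' : ∀ n, mulPC F p W (u' (n + 1)) = u' n)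
    (hu₀ : (((u 0 : (maxNilIdealC F).toIdeal) : CBall F) : CompletedAlgClosure F) = 0)
    (hu'₀ : (((u' 0 : (maxNilIdealC F).toIdeal) : CBall F) : CompletedAlgClosure F) = 0)
    {N N' : ℕ} (hN : 1 ≤ N) (hN' : 1 ≤ N') {z z' : bmaxZero F p}
    (hz : algebraMap (Ainf (p := p) F) (bmaxZero F p)
        ((AinfTop.of F p).symm (((divisionLiftPt W hθ u hup).val : (nilTheta F p hθ).toIdeal) : AinfTop F p)) ^ N =
      (p : bmaxZero F p) * z)
    (hz' : algebraMap (Ainf (p := p) F) (bmaxZero F p)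
        ((AinfTop.of F p).symm (((divisionLiftPt W hθ u' hup').val : (nilTheta F p hθ).toIdeal) : AinfTop F p)) ^ N' =
      (p : bmaxZero F p) * z')
    {k : ℕ} {L : BDeRhamPlus (integerC F) p} {r : ℕ}
    (hL : ∀ M₁ M : ℕ, M₁ + r ≤ M → ∀ y : bmaxZero F p,
      AdicCompletion.evalₐ (Ideal.span {(p : bmaxZero F p)}) M
          (PadicLogSeries.logSum ((algebraMap (Ainf (p := p) F) (bmaxZero F p)).comp zpToAinf) (GaloisContinuity.formalLogNum W p) N
              (algebraMap (Ainf (p := p) F) (bmaxZero F p)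
                ((AinfTop.of F p).symm (((divisionLiftPt W hθ u hup).val : (nilTheta F p hθ).toIdeal) : AinfTop F p))) z *
            frobBmaxPlus F p (PadicLogSeries.logSum ((algebraMap (Ainf (p := p) F) (bmaxZero F p)).comp zpToAinf)
              (GaloisContinuity.formalLogNum W p) N'
              (algebraMap (Ainf (p := p) F) (bmaxZero F p)
                ((AinfTop.of F p).symm (((divisionLiftPt W hθ u' hup').val : (nilTheta F p hθ).toIdeal) : AinfTop F p))) z') -
          frobBmaxPlus F p (PadicLogSeries.logSum ((algebraMap (Ainf (p := p) F) (bmaxZero F p)).comp zpToAinf)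
              (GaloisContinuity.formalLogNum W p) N
              (algebraMap (Ainf (p := p) F) (bmaxZero F p)
                ((AinfTop.of F p).symm (((divisionLiftPt W hθ u hup).val : (nilTheta F p hθ).toIdeal) : AinfTop F p))) z) *
            PadicLogSeries.logSum ((algebraMap (Ainf (p := p) F) (bmaxZero F p)).comp zpToAinf) (GaloisContinuity.formalLogNum W p) N'
              (algebraMap (Ainf (p := p) F) (bmaxZero F p)
                ((AinfTop.of F p).symm (((divisionLiftPt W hθ u' hup').val : (nilTheta F p hθ).toIdeal) : AinfTop F p))) z') =
        Ideal.Quotient.mk _ y →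
      ∃ (c : Ainf (p := p) F) (w : BDeRhamPlus (integerC F) p),
        (p : BDeRhamPlus (integerC F) p) ^ k *
            (L - algebraMap (Localization.Away (p : Ainf (p := p) F)) (BDeRhamPlus (integerC F) p)
              (y : Localization.Away (p : Ainf (p := p) F))) =
          ainfToBdR ((p : Ainf (p := p) F) ^ M₁ * c) + xiBdR ^ k * w) :
    ∃ lam : ℤ_[p], (p : BDeRhamPlus (integerC F) p) ^ 2 * L - qpToBdR (lam : ℚ_[p]) * tBdR ∈
      Ideal.span {(xiBdR : BDeRhamPlus (integerC F) p) ^ k} := by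
  have hφ := frobBmaxPlus_det_logSum_divisionLiftPt W (hθ := hθ) a e he hup hup' hN hN' hz hz'
  have hθ0 := thetaBmaxPlus_det_eq_zero (frobBmaxPlus F p)
      (thetaBmaxPlus_logSum_divisionLiftPt_eq_zero W (GaloisContinuity.formalLogNum W p) hup hu₀ hN hz)
      (thetaBmaxPlus_logSum_divisionLiftPt_eq_zero W (GaloisContinuity.formalLogNum W p) hup' hu'₀ hN' hz')
  exact exists_sq_mul_sub_smul_tBdR_mem_of_bdR_lim_modFil hθ hφ hθ0 hL

end AinfTop

end Literature.NumberTheory.PAdicHodge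

end
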